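import Mathlib
import Literature.MathematicalPhysics.StatisticalMechanics.FccTexturedSet
import Literature.Analysis.Convexity.AnisotropicPerimeter
import HarnessLib

/-!
# Line `TexShadow` for the crux `TextureLiminf` (stmt-Ventures-19483) — CONTINUUM DEFINITIONS file

HONEST FRAMING. Part of the venture `Summits/Ventures/Crystal3D` (cell `crystal3d-full`), route
`route-Ventures-StickyWulffConstant`, crux `TextureLiminf` (stmt-Ventures-19483).  This file carries,
VERBATIM, the continuum vocabulary of the planner's REGISTERED skeleton
`HOME/cf-p1/route/lines/tex/TexShadow.lean` (planner crystal3d-full-p1 gen 16, v4; `ledger skeleton check`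
OK; evidence on stmt-Ventures-19483): the ambient space `E3`, the route's distributional anisotropic
perimeter `perK` / `per`, the support function `supportFn`, the prism area `facetArea`, the open
`H`-polytope `polytope`, and the `Prop` `PolytopeCalculus` of the registered stub
`stub_polytopeCalculus : PolytopeCalculus`, so that this stub (pure continuum; shared with the `P` line's
`stub_polyhedral`) can be proved BY NAME in `Theorems/` files against exactly these names.  The
atomistic vocabulary of the skeleton (stackings, plates, walls, `ShadowTheorem`, …) is NOT here (it
needs the venture's `Bulk`/`StickySpheres` imports and is still being revised — v2 → v4 on
2026-08-27); a later definitions file for it should `import` this one rather than redeclare `E3`,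
`perK`, `per`.  Imports are route-independent (no `Theses` import); declarations unchanged.

`PolytopeCalculus` (facet calculus for the route's distributional anisotropic perimeter; Maggi 2012
§20.1 / the divergence theorem on polytopes): for a compact convex body `K ∋ 0`,
(A) a bounded open convex polytope with unit outer normals and pairwise distinct facet planes has
`Per_K = Σ_facets h_K(ν_F)·area(F)`; (B) for finitely many pairwise disjoint such polytopes with
separating unit normals `ν i j`,
`Per_K(⋃ Q_i) = Σ Per_K(Q_i) − Σ_{i<j} (h_K(ν_ij) + h_K(−ν_ij))·area(Q̄_i ∩ Q̄_j)`.
`facetArea F ν` is the VOLUME of the unit prism over the planar piece `F` (deliberately not Mathlib's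
unnormalised `μH[2]`).
WHAT THIS IS NOT: a proof of the stub (that is `Theorems/StickyWulffConstantTextureLiminfPolytopeCalculus*.lean`);
rung F-C1 not moved.
-/

noncomputable section

open scoped BigOperators InnerProductSpace ENNReal
open MeasureTheory Filter

namespace Summit.Ventures.Crystal3D.Cruxes.TextureLiminf.TexShadow

open Literature.MathematicalPhysics.StatisticalMechanics (fieldDivergence)

/-- ambient space -/
abbrev E3 := EuclideanSpace ℝ (Fin 3)

/-- anisotropic De Giorgi perimeter with constraint body `K`. -/
noncomputable def perK (K G : Set E3) : ℝ≥0∞ :=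
  ⨆ (η : E3 → E3) (_ : ContDiff ℝ 1 η ∧ HasCompactSupport η ∧ ∀ x, η x ∈ K),
    ENNReal.ofReal (∫ x in G, fieldDivergence η x)

/-- its real value -/
noncomputable def per (K G : Set E3) : ℝ := (perK K G).toReal

/-- support function of the constraint body. -/
noncomputable def supportFn (K : Set E3) (ν : E3) : ℝ := sSup ((fun y => ⟪y, ν⟫_ℝ) '' K)

/-- area of a planar piece `F` with unit normal `ν`, as the VOLUME of the unit prism over it (this avoids
the `4/π` normalisation of Mathlib's unnormalised `μH[2]` on Euclidean planes). -/
noncomputable def facetArea (F : Set E3) (ν : E3) : ℝ :=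
  (volume {x : E3 | ∃ y ∈ F, ∃ t ∈ Set.Icc (0 : ℝ) 1, x = y + t • ν}).toReal

/-- the open convex polytope with `H`-representation `H` (outer normals `p.1`, levels `p.2`). -/
def polytope (H : Finset (E3 × ℝ)) : Set E3 := ⋂ p ∈ H, {x | ⟪p.1, x⟫_ℝ < p.2}

/-- **Facet calculus for the route's distributional anisotropic perimeter** (pure continuum, in print —
divergence theorem on polytopes; Maggi 2012 §20.1): for a compact convex body `K ∋ 0`,
(A) a bounded open convex polytope with unit outer normals and pairwise distinct facet planes has
`Per_K = Σ_facets h_K(ν_F)·area(F)`; (B) for finitely many pairwise disjoint such polytopes with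
separating unit normals `ν i j`, `Per_K(⋃ Q_i) = Σ Per_K(Q_i) − Σ_{i<j} (h_K(ν_ij) + h_K(−ν_ij))·area(Q̄_i ∩ Q̄_j)`.
With the route's `iface` this gives wall and coherent-interface terms of polyhedral textures as facet sums
(shared with the P line's `stub_polyhedral`). -/
def PolytopeCalculus : Prop :=
  ∀ K : Set E3, IsCompact K → Convex ℝ K → (0 : E3) ∈ K →
    (∀ H : Finset (E3 × ℝ), Bornology.IsBounded (polytope H) → (∀ p ∈ H, ‖p.1‖ = 1) →
      (∀ p ∈ H, ∀ p' ∈ H, p ≠ p' → {x : E3 | ⟪p.1, x⟫_ℝ = p.2} ≠ {x | ⟪p'.1, x⟫_ℝ = p'.2}) →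
      per K (polytope H) =
        ∑ p ∈ H, supportFn K p.1 * facetArea (closure (polytope H) ∩ {x | ⟪p.1, x⟫_ℝ = p.2}) p.1) ∧
    (∀ (k : ℕ) (H : Fin k → Finset (E3 × ℝ)) (ν : Fin k → Fin k → E3),
      (∀ i, Bornology.IsBounded (polytope (H i))) →
      (∀ i j, i ≠ j → Disjoint (polytope (H i)) (polytope (H j))) →
      (∀ i j, i ≠ j → ‖ν i j‖ = 1 ∧ ∃ b : ℝ,
        closure (polytope (H i)) ∩ closure (polytope (H j)) ⊆ {x | ⟪ν i j, x⟫_ℝ = b}) →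
      per K (⋃ i, polytope (H i)) =
        ∑ i, per K (polytope (H i)) -
          ∑ i, ∑ j, (if i < j then (supportFn K (ν i j) + supportFn K (-ν i j)) *
            facetArea (closure (polytope (H i)) ∩ closure (polytope (H j))) (ν i j) else 0))

/-- sanity: the route's let-spelled anisotropic perimeter is the Literature one. -/
theorem perK_eq_anisotropicPerimeter (K G : Set E3) :
    perK K G = Literature.Analysis.Convexity.anisotropicPerimeter K G := rfl

end Summit.Ventures.Crystal3D.Cruxes.TextureLiminf.TexShadow

end
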